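/-
Copyright (c) 2026 the pub-hodgecm-mathlib formalisation cell (harness21).  Prover seat hodgecm-mathlib-F0P2-p01 (g16): road «S3-ram» (LEAD F0P3a-plan (g13); owner F0P3a-p06 (g15∕g16)),
(T2) G-side organ (Cnt2′) (chair F0P3a-p07 (g14) rulings (3)(6)(8)), organ (z1-c) «TUBE LAYERS b ≥ 1», item (c1-iv) THE COLLAR GATE; 2026-09-02.
-/
import Literature.NumberTheory.Automorphic.UnitaryLatticeTreeTubeCollarTokens   -- ★ p848616 (this seat); brings ★ TubeCone (c3-ii) anatomy, ★ TubeAxisVertex `exists_axisVertex_eq_latt_endoGL`, ★ AxisCountTransport `latt_endoGL_one_eq_iff`, ★ BlockGluing `pairing_comm_of_hermitian`, ★ Apartment `dualLatt_eq_self_of_isSelfDualLattice`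
import HarnessLib

/-!
# The lattice graph of a hermitian space — THE COLLAR GATE: a self-dual plane lattice is determined by any unimodular vector in it; hence the axis vertex `A(M)` of a collar
# lattice `M` is the ONLY self-dual axis vertex containing `ϖ·M` (Kottwitz 1986 §3; Jacobowitz 1962 §4; Bruhat–Tits 1972 §10)

Topic `NumberTheory/Automorphic`; namespace `Literature.NumberTheory.Automorphic.UnitaryLatticeTree`.  THEOREMS ONLY (no definition, no instance, no notation, no named fact,
no `sorry`); kernel lane `--supports stmt-HodgeConjecture-24833`; datum-free (`K` with `Valued K ℤᵐ⁰`; `[IsPrincipalIdealRing 𝒪[K]]` in §2).  Cell `pub/hodgecm-mathlib`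
(D-0151), crux H413; road «S3-ram» (Literature seeding, count-neutral); (T2) G-side organ (Cnt2′) (chair F0P3a-p07 (g14)), organ (z1-c) «TUBE LAYERS b ≥ 1» (★
`UnitaryLatticeTreeTubeCoordinate` p848197 ∕ `…TubeAxisVertex` p848332 ∕ `…TubeCone` p848446 ∕ `…TubeCollarTokens` p848616 ∕ `…TubeCollarTopLevel`), census item (c1-iv)
THE GATE in containment currency — the bridge between the tree's «grandchildren of the axis vertex `v`» (★ `scaleLattice_le_and_le_of_adj_of_isSelfDualLattice`, F0P2-p02
(g14): `ϖ·w ≤ v`) and the collar currency `A(w) = v` under which the COLLAR TOKENS (K0)–(K4) are stated.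
BLOCK CURRENCY: `H = !![H₂ 0 0, 0, H₂ 0 1; 0, h, 0; H₂ 1 0, 0, H₂ 1 1]` (`IsUnit H₂.det`, `(H₂.map σ)ᵀ = H₂`, `|h| = 1`, `σh = h`), `W = ⟨e₀, e₂⟩`, SD axis vertices `latt ι(g, 1) =
latt g ⊕ 𝒪e₁` (`latt g` self-dual for `H₂`), collar lattice `M` (self-dual, tube coordinate `1`, generator `x₀`), `A(M) = (M ∩ W) ⊔ ϖ·M ⊔ 𝒪e₁`, `z = ϖ·(x₀ − x₀(1)e₁)`.

THE MATHEMATICS.  (1) RIGIDITY (§1): two self-dual `𝒪`-lattices `B, B′ ⊂ K²` for a hermitian `H₂` that share a vector `z` with `|⟨z, z⟩| = 1` are EQUAL.  Indeed for `b ∈ B`,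
`b′ ∈ B′` write `b = λz + p`, `b′ = μz + p′` with `λ = ⟨z,b⟩∕⟨z,z⟩`, `μ = ⟨z,b′⟩∕⟨z,z⟩ ∈ 𝒪` and `p ∈ B`, `p′ ∈ B′` orthogonal to `z`; `z^⊥` is a LINE, so `det[p, p′] = 0` and the
Gram identity `⟨p,p⟩⟨p′,p′⟩ − ⟨p,p′⟩⟨p′,p⟩ = σ(det[p,p′])·det[p,p′]·det H₂` (`pairing_mul_pairing_sub_eq_det_fin_two`) gives `|⟨p, p′⟩|² = |⟨p,p⟩|·|⟨p′,p′⟩| ≤ 1`; hence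
`⟨b, b′⟩ = σ(λ)μ⟨z,z⟩ + ⟨p,p′⟩ ∈ 𝒪`, i.e. `B′ ⊆ B^# = B` (`eq_of_isSelfDualLattice_of_mem_of_v_pairing_eq_one`).  (2) THE GATE (§2): if `M` is a collar lattice and `latt ι(g,1)`
a self-dual axis vertex with `ϖ·M ≤ latt ι(g, 1)`, then `ϖx₀ = z + ϖx₀(1)·e₁ ∈ latt ι(g,1)` puts `z_W ∈ latt g`; also `z_W ∈ latt g₂` where `A(M) = latt ι(g₂, 1)` (★
`exists_axisVertex_eq_latt_endoGL`), and `|⟨z_W, z_W⟩_{H₂}| = |⟨z, z⟩_H| = 1` (★ (c3-ii)); by (1) `latt g = latt g₂`, so **`A(M) = latt ι(g, 1)`** (`axisVertex_eq_latt_endoGL_of_scaleLattice_le`);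
with `ϖ·M ≤ A(M)` (definition of `A(M)`): **`A(M) = latt ι(g,1) ⟺ ϖ·M ≤ latt ι(g,1)`** (`axisVertex_eq_latt_endoGL_iff_scaleLattice_le`) — the collar of `v` (the
lattices to which (K0)–(K4) apply with `A(M) = v`) is exactly the set of self-dual `M` of tube coordinate `1` with `ϖ·M ≤ v`.

* §1 `pairing_eq_lin_fin_two` (bookkeeping), `pairing_mul_pairing_sub_eq_det_fin_two` (Gram determinant), `det_fin_two_eq_zero_of_pairing_eq_zero` (`z^⊥` is a line),
  `le_of_isSelfDualLattice_of_mem_of_v_pairing_eq_one`, **`eq_of_isSelfDualLattice_of_mem_of_v_pairing_eq_one`**.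
* §2 **`axisVertex_eq_latt_endoGL_of_scaleLattice_le`**, **`axisVertex_eq_latt_endoGL_iff_scaleLattice_le`**.

HONEST LABEL: HC_CM is proved only modulo the 2 remaining named inputs (hLiu418 24832, h413 24833) until rung 0 closes; nothing printed is asserted here (elementary lattice
algebra over a discretely valued field); «S3-ram» has no books consequence.

## References
* [Jacobowitz1962] R. Jacobowitz, *Hermitian forms over local fields*, Amer. J. Math. 84 (1962), §4 (unimodular vectors split off; Gram determinants).
* [Kottwitz1986] R. E. Kottwitz, *Base change for unit elements of Hecke algebras*, Compositio Math. 60 (1986), §3 (lattice bookkeeping for fixed-point counts).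
* [BruhatTits1972] F. Bruhat, J. Tits, *Groupes réductifs sur un corps local I*, Publ. Math. IHÉS 41 (1972), §10 (lattice models; convexity of the axis).
* [Rogawski1990] J. D. Rogawski, *Automorphic Representations of Unitary Groups in Three Variables*, Ann. of Math. Stud. 123 (1990), §4.8 Case (a) p. 53 (the pattern `ι`).
-/

set_option autoImplicit false

noncomputable section

open scoped Valued WithZero Matrix MatrixGroups

namespace Literature.NumberTheory.Automorphic.UnitaryLatticeTree

open Literature.NumberTheory.Automorphic Literature.NumberTheory.Automorphic.HermitianLattice Literature.NumberTheory.Rogawski1990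

variable {K : Type*} [Field K] [Valued K ℤᵐ⁰]

/-! ## §1 RIGIDITY: a self-dual `H₂`-lattice is determined by any unimodular vector in it -/

omit [Valued K ℤᵐ⁰] in
/-- Bookkeeping: `⟨z, y⟩ = a₀·y₀ + a₁·y₁` with `a_j = Σ_i σ(z_i)H_{ij}`. [cite: Jacobowitz1962, §4] -/
theorem pairing_eq_lin_fin_two (σ : K →+* K) (H₂ : Matrix (Fin 2) (Fin 2) K) (z y : Fin 2 → K) :
    pairing σ H₂ z y = (σ (z 0) * H₂ 0 0 + σ (z 1) * H₂ 1 0) * y 0 + (σ (z 0) * H₂ 0 1 + σ (z 1) * H₂ 1 1) * y 1 := by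
  simp [pairing_apply, Fin.sum_univ_two]
  ring

omit [Valued K ℤᵐ⁰] in
/-- **Gram determinant** of two plane vectors: `⟨p,p⟩⟨p′,p′⟩ − ⟨p,p′⟩⟨p′,p⟩ = σ(det[p,p′])·det[p,p′]·det H₂`. [cite: Jacobowitz1962, §4] -/
theorem pairing_mul_pairing_sub_eq_det_fin_two (σ : K →+* K) (H₂ : Matrix (Fin 2) (Fin 2) K) (p p' : Fin 2 → K) :
    pairing σ H₂ p p * pairing σ H₂ p' p' - pairing σ H₂ p p' * pairing σ H₂ p' p =
      σ (p 0 * p' 1 - p 1 * p' 0) * (p 0 * p' 1 - p 1 * p' 0) * H₂.det := by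
  simp [pairing_apply, Fin.sum_univ_two, Matrix.det_fin_two, map_sub, map_mul]
  ring

omit [Valued K ℤᵐ⁰] in
/-- `z^⊥` is a LINE: if `⟨z, z⟩ ≠ 0` and `⟨z, p⟩ = ⟨z, p′⟩ = 0` then `det[p, p′] = 0`. [cite: Jacobowitz1962, §4] -/
theorem det_fin_two_eq_zero_of_pairing_eq_zero (σ : K →+* K) (H₂ : Matrix (Fin 2) (Fin 2) K) {z p p' : Fin 2 → K} (hzz : pairing σ H₂ z z ≠ 0)
    (hp : pairing σ H₂ z p = 0) (hp' : pairing σ H₂ z p' = 0) : p 0 * p' 1 - p 1 * p' 0 = 0 := by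
  rw [pairing_eq_lin_fin_two] at hzz hp hp'
  by_cases ha0 : σ (z 0) * H₂ 0 0 + σ (z 1) * H₂ 1 0 = 0
  · rw [ha0, zero_mul, zero_add] at hzz hp hp'
    have ha1 : σ (z 0) * H₂ 0 1 + σ (z 1) * H₂ 1 1 ≠ 0 := fun h0 => hzz (by rw [h0, zero_mul])
    have h1 : p 1 = 0 := (mul_eq_zero.1 hp).resolve_left ha1
    have h2 : p' 1 = 0 := (mul_eq_zero.1 hp').resolve_left ha1
    rw [h1, h2]; ring
  · refine mul_left_cancel₀ ha0 ?_
    linear_combination (p' 1) * hp - (p 1) * hp'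

/-- One inclusion of the rigidity: `B` SELF-DUAL, `B′` INTEGRAL (`B′ ⊆ B′^#`), `z ∈ B ∩ B′` with `|⟨z, z⟩| = 1` ⇒ `B′ ≤ B`. [cite: Jacobowitz1962, §4] [cite: Kottwitz1986, §3] -/
theorem le_of_isSelfDualLattice_of_mem_of_v_pairing_eq_one (σ : K →+* K) (hσ : ∀ a, σ (σ a) = a) (hvσ : ∀ a, Valued.v (σ a) = Valued.v a) {ϖ : K}
    {H₂ : Matrix (Fin 2) (Fin 2) K} (hH₂ : IsUnit H₂.det) (hH₂σ : (H₂.map σ)ᵀ = H₂)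
    {B B' : Submodule 𝒪[K] (Fin 2 → K)} (hB : IsSelfDualLattice σ ϖ H₂ B) (hB' : B' ≤ dualLatt σ H₂ B')
    {z : Fin 2 → K} (hzB : z ∈ B) (hzB' : z ∈ B') (hzz : Valued.v (pairing σ H₂ z z) = 1) : B' ≤ B := by
  have hHab : ∀ a b, σ (H₂ a b) = H₂ b a := fun a b => by
    have e := congrFun (congrFun hH₂σ b) a
    rw [Matrix.transpose_apply, Matrix.map_apply] at e
    exact e
  have hcomm := pairing_comm_of_hermitian hσ hHab
  have hBeq := dualLatt_eq_self_of_isSelfDualLattice hvσ hH₂ hB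
  have hBd : ∀ x ∈ B, ∀ y ∈ B, Valued.v (pairing σ H₂ x y) ≤ 1 := fun x hx y hy =>
    (mem_dualLatt σ H₂ B y).1 (by rw [hBeq]; exact hy) x hx
  have hB'd : ∀ x ∈ B', ∀ y ∈ B', Valued.v (pairing σ H₂ x y) ≤ 1 := fun x hx y hy => (mem_dualLatt σ H₂ B' y).1 (hB' hy) x hx
  have hzz0 : pairing σ H₂ z z ≠ 0 := fun h0 => by rw [h0, map_zero] at hzz; exact zero_ne_one hzz
  intro b' hb'
  rw [← hBeq, mem_dualLatt]
  intro b hb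
  -- orthogonal decomposition along `z`
  obtain ⟨l, hl⟩ : ∃ l : K, l = pairing σ H₂ z b / pairing σ H₂ z z := ⟨_, rfl⟩
  obtain ⟨m, hm⟩ : ∃ m : K, m = pairing σ H₂ z b' / pairing σ H₂ z z := ⟨_, rfl⟩
  obtain ⟨p, hp⟩ : ∃ p : Fin 2 → K, p = b - l • z := ⟨_, rfl⟩
  obtain ⟨p', hp'⟩ : ∃ p' : Fin 2 → K, p' = b' - m • z := ⟨_, rfl⟩
  have hl1 : Valued.v l ≤ 1 := by rw [hl, map_div₀, hzz, div_one]; exact hBd z hzB b hb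
  have hm1 : Valued.v m ≤ 1 := by rw [hm, map_div₀, hzz, div_one]; exact hB'd z hzB' b' hb'
  have hpB : p ∈ B := by rw [hp]; exact B.sub_mem hb (smul_mem_of_v_le B hl1 hzB)
  have hp'B' : p' ∈ B' := by rw [hp']; exact B'.sub_mem hb' (smul_mem_of_v_le B' hm1 hzB')
  have hzp : pairing σ H₂ z p = 0 := by
    rw [hp, LinearMap.map_sub, LinearMap.map_smul, smul_eq_mul, hl, div_mul_cancel₀ _ hzz0, sub_self]
  have hzp' : pairing σ H₂ z p' = 0 := by
    rw [hp', LinearMap.map_sub, LinearMap.map_smul, smul_eq_mul, hm, div_mul_cancel₀ _ hzz0, sub_self]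
  have hpz : pairing σ H₂ p z = 0 := by rw [hcomm, hzp, map_zero]
  -- `|⟨p, p′⟩| ≤ 1` by the Gram determinant on the line `z^⊥`
  have hpp' : Valued.v (pairing σ H₂ p p') ≤ 1 := by
    have hdet := det_fin_two_eq_zero_of_pairing_eq_zero σ H₂ hzz0 hzp hzp'
    have hG := pairing_mul_pairing_sub_eq_det_fin_two σ H₂ p p'
    rw [hdet, map_zero, zero_mul, zero_mul, sub_eq_zero] at hG
    have hv := congrArg Valued.v hG
    rw [map_mul, map_mul, v_pairing_comm_of_hermitian hvσ hσ hHab p p'] at hv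
    -- `|⟨p,p′⟩|² = |⟨p,p⟩|·|⟨p′,p′⟩| ≤ 1`
    have hle : Valued.v (pairing σ H₂ p p') * Valued.v (pairing σ H₂ p p') ≤ 1 := by
      rw [← hv]; exact mul_le_one' (hBd p hpB p hpB) (hB'd p' hp'B' p' hp'B')
    by_contra hgt
    rw [not_le] at hgt
    exact absurd hle (not_le.2 (one_lt_mul_of_lt_of_le' hgt hgt.le))
  -- `⟨b, b′⟩ = σ(l)·m·⟨z,z⟩ + ⟨p, p′⟩`
  have eb : b = l • z + p := by rw [hp]; abel
  have eb' : b' = m • z + p' := by rw [hp']; abel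
  have e : pairing σ H₂ b b' = σ l * (m * pairing σ H₂ z z) + pairing σ H₂ p p' := by
    rw [eb, eb']
    simp only [map_add, map_smulₛₗ, LinearMap.add_apply, LinearMap.smul_apply, smul_eq_mul, RingHom.id_apply, hzp', hpz]
    ring
  rw [e]
  refine (Valuation.map_add _ _ _).trans (max_le ?_ hpp')
  rw [map_mul, map_mul, hvσ, hzz, mul_one]
  exact mul_le_one' hl1 hm1

/-- **RIGIDITY: a self-dual `H₂`-lattice is determined by any unimodular vector in it** — `B, B′` self-dual, `z ∈ B ∩ B′`, `|⟨z, z⟩| = 1` ⇒ `B = B′`.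
[cite: Jacobowitz1962, §4] [cite: Kottwitz1986, §3] -/
theorem eq_of_isSelfDualLattice_of_mem_of_v_pairing_eq_one (σ : K →+* K) (hσ : ∀ a, σ (σ a) = a) (hvσ : ∀ a, Valued.v (σ a) = Valued.v a) {ϖ : K}
    {H₂ : Matrix (Fin 2) (Fin 2) K} (hH₂ : IsUnit H₂.det) (hH₂σ : (H₂.map σ)ᵀ = H₂)
    {B B' : Submodule 𝒪[K] (Fin 2 → K)} (hB : IsSelfDualLattice σ ϖ H₂ B) (hB' : IsSelfDualLattice σ ϖ H₂ B')
    {z : Fin 2 → K} (hzB : z ∈ B) (hzB' : z ∈ B') (hzz : Valued.v (pairing σ H₂ z z) = 1) : B = B' :=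
  le_antisymm (le_of_isSelfDualLattice_of_mem_of_v_pairing_eq_one σ hσ hvσ hH₂ hH₂σ hB' (le_dualLatt_of_isVertexLattice hvσ hB) hzB' hzB hzz)
    (le_of_isSelfDualLattice_of_mem_of_v_pairing_eq_one σ hσ hvσ hH₂ hH₂σ hB (le_dualLatt_of_isVertexLattice hvσ hB') hzB hzB' hzz)

/-! ## §2 (c1-iv) THE COLLAR GATE: `A(M)` is the only self-dual axis vertex containing `ϖ·M` -/

/-- **THE COLLAR GATE.**  Block form; `M` self-dual with tube coordinate `1` (a collar lattice); `latt ι(g, 1)` a SELF-DUAL axis vertex (`latt g` self-dual for `H₂`) with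
`ϖ·M ≤ latt ι(g, 1)`.  Then `A(M) = (M ∩ W) ⊔ ϖM ⊔ 𝒪e₁ = latt ι(g, 1)`: the glued vector `z = ϖ(x₀ − x₀(1)e₁)` has `z_W ∈ latt g ∩ latt g₂` (`A(M) = latt ι(g₂,1)`, ★
`exists_axisVertex_eq_latt_endoGL`) and `|⟨z_W, z_W⟩| = 1` (★ (c3-ii)), so `latt g = latt g₂` by rigidity. [cite: Kottwitz1986, §3] [cite: BruhatTits1972, §10] -/
theorem axisVertex_eq_latt_endoGL_of_scaleLattice_le [IsPrincipalIdealRing 𝒪[K]] (σ : K →+* K) (hσ : ∀ a, σ (σ a) = a) (hvσ : ∀ a, Valued.v (σ a) = Valued.v a)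
    {ϖ : K} (hϖ : Valued.v ϖ = WithZero.exp (-1 : ℤ))
    {H₂ : Matrix (Fin 2) (Fin 2) K} (hH₂ : IsUnit H₂.det) (hH₂σ : (H₂.map σ)ᵀ = H₂) {h : K} (hh : Valued.v h = 1) (hhσ : σ h = h)
    {M : Submodule 𝒪[K] (Fin 3 → K)} (hM : IsSelfDualLattice σ ϖ (!![H₂ 0 0, 0, H₂ 0 1; 0, h, 0; H₂ 1 0, 0, H₂ 1 1] : Matrix (Fin 3) (Fin 3) K) M)
    (hb : ∀ a : K, (Pi.single 1 a : Fin 3 → K) ∈ M ↔ Valued.v a ≤ Valued.v ϖ ^ 1)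
    {g : GL (Fin 2) K} (hg : IsSelfDualLattice σ ϖ H₂ (latt (g : Matrix (Fin 2) (Fin 2) K)))
    (hle : scaleLattice (ϖ ^ 1) M ≤ latt ((endoGL (g, (1 : GL (Fin 1) K)) : GL (Fin 3) K) : Matrix (Fin 3) (Fin 3) K)) :
    M ⊓ LinearMap.ker ((LinearMap.proj (1 : Fin 3) : (Fin 3 → K) →ₗ[K] K).restrictScalars 𝒪[K]) ⊔ scaleLattice (ϖ ^ 1) M ⊔ Submodule.span 𝒪[K] {(Pi.single 1 1 : Fin 3 → K)} = latt ((endoGL (g, (1 : GL (Fin 1) K)) : GL (Fin 3) K) : Matrix (Fin 3) (Fin 3) K) := by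
  have hϖ0' : Valued.v ϖ ≠ 0 := by rw [hϖ]; exact WithZero.exp_ne_zero
  have hϖ0 : ϖ ≠ 0 := fun h0 => by rw [h0, map_zero] at hϖ0'; exact hϖ0' rfl
  obtain ⟨hpr, x₀, hx₀, hx₀1⟩ : (∀ x ∈ M, Valued.v (x 1) * Valued.v ϖ ^ 1 ≤ 1) ∧ ∃ x₀ ∈ M, Valued.v (x₀ 1) * Valued.v ϖ ^ 1 = 1 := by
    obtain ⟨b', hb', hpr, x₀, hx₀, hx₀1⟩ := exists_tubeCoordinate σ hvσ hϖ hH₂ hh hM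
    obtain ⟨hbb, -⟩ := tubeCoordinate_unique hϖ hb hb'
    subst hbb
    exact ⟨hpr, x₀, hx₀, hx₀1⟩
  obtain ⟨g₂, hg₂, hA, -⟩ := exists_axisVertex_eq_latt_endoGL σ hσ hvσ hϖ hH₂ hH₂σ hh hhσ hM hb
  obtain ⟨hzA, hzz, -, -⟩ := cone_anatomy_of_tubeCoordinate σ hvσ hϖ hH₂ hh hM (le_refl 1) hb hx₀ hx₀1
  -- `z_W ∈ latt g₂` and `z_W ∈ latt g`
  have hz2 : (![(((ϖ ^ 1) • (x₀ - Pi.single 1 (x₀ 1))) : Fin 3 → K) 0, (((ϖ ^ 1) • (x₀ - Pi.single 1 (x₀ 1))) : Fin 3 → K) 2] : Fin 2 → K) ∈ latt (g₂ : Matrix (Fin 2) (Fin 2) K) := by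
    rw [← hA] at hzA; exact ((mem_latt_endoGL_one_iff g₂ _).1 hzA).1
  have hzg : (![(((ϖ ^ 1) • (x₀ - Pi.single 1 (x₀ 1))) : Fin 3 → K) 0, (((ϖ ^ 1) • (x₀ - Pi.single 1 (x₀ 1))) : Fin 3 → K) 2] : Fin 2 → K) ∈ latt (g : Matrix (Fin 2) (Fin 2) K) := by
    -- `ϖx₀ ∈ ϖM ≤ latt ι(g,1)`, and `(ϖx₀)_W = z_W`
    have hϖx : (ϖ ^ 1) • x₀ ∈ latt ((endoGL (g, (1 : GL (Fin 1) K)) : GL (Fin 3) K) : Matrix (Fin 3) (Fin 3) K) :=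
      hle ((mem_scaleLattice_iff (pow_ne_zero 1 hϖ0) _ _).2 (by rw [smul_smul, inv_mul_cancel₀ (pow_ne_zero 1 hϖ0), one_smul]; exact hx₀))
    have h1 := ((mem_latt_endoGL_one_iff g _).1 hϖx).1
    have e : (![((ϖ ^ 1) • x₀ : Fin 3 → K) 0, ((ϖ ^ 1) • x₀ : Fin 3 → K) 2] : Fin 2 → K) = ![(((ϖ ^ 1) • (x₀ - Pi.single 1 (x₀ 1))) : Fin 3 → K) 0, (((ϖ ^ 1) • (x₀ - Pi.single 1 (x₀ 1))) : Fin 3 → K) 2] := by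
      ext i; fin_cases i <;> simp
    rw [e] at h1; exact h1
  -- `|⟨z_W, z_W⟩_{H₂}| = |⟨z, z⟩| = 1`
  have hzzW : Valued.v (pairing σ H₂ (![(((ϖ ^ 1) • (x₀ - Pi.single 1 (x₀ 1))) : Fin 3 → K) 0, (((ϖ ^ 1) • (x₀ - Pi.single 1 (x₀ 1))) : Fin 3 → K) 2] : Fin 2 → K) ![(((ϖ ^ 1) • (x₀ - Pi.single 1 (x₀ 1))) : Fin 3 → K) 0, (((ϖ ^ 1) • (x₀ - Pi.single 1 (x₀ 1))) : Fin 3 → K) 2]) = 1 := by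
    have e := pairing_endoShape_apply σ H₂ h ((ϖ ^ 1) • (x₀ - Pi.single 1 (x₀ 1))) ((ϖ ^ 1) • (x₀ - Pi.single 1 (x₀ 1)))
    have hz1 : (((ϖ ^ 1) • (x₀ - Pi.single 1 (x₀ 1))) : Fin 3 → K) 1 = 0 := by simp
    rw [hz1, map_zero, zero_mul, zero_mul, add_zero] at e
    rw [← e]; exact hzz
  have hgg : latt (g : Matrix (Fin 2) (Fin 2) K) = latt (g₂ : Matrix (Fin 2) (Fin 2) K) :=
    eq_of_isSelfDualLattice_of_mem_of_v_pairing_eq_one σ hσ hvσ hH₂ hH₂σ hg hg₂ hzg hz2 hzzW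
  rw [← hA, latt_endoGL_one_eq_iff, hgg]

/-- **THE COLLAR GATE, iff form**: for a collar lattice `M` and a self-dual axis vertex `latt ι(g,1)`: `A(M) = latt ι(g,1) ⟺ ϖ·M ≤ latt ι(g,1)` (⇐ the gate; ⇒ ★
`scaleLattice_axisVertex_le`).  So the lattices to which the COLLAR TOKENS (K0)–(K4) apply with `A(M) = v` are exactly the self-dual `M` of tube coordinate `1` with
`ϖ·M ≤ v` — the tree's non-axis grandchildren of `v`. [cite: Kottwitz1986, §3] [cite: BruhatTits1972, §10] -/
theorem axisVertex_eq_latt_endoGL_iff_scaleLattice_le [IsPrincipalIdealRing 𝒪[K]] (σ : K →+* K) (hσ : ∀ a, σ (σ a) = a) (hvσ : ∀ a, Valued.v (σ a) = Valued.v a)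
    {ϖ : K} (hϖ : Valued.v ϖ = WithZero.exp (-1 : ℤ))
    {H₂ : Matrix (Fin 2) (Fin 2) K} (hH₂ : IsUnit H₂.det) (hH₂σ : (H₂.map σ)ᵀ = H₂) {h : K} (hh : Valued.v h = 1) (hhσ : σ h = h)
    {M : Submodule 𝒪[K] (Fin 3 → K)} (hM : IsSelfDualLattice σ ϖ (!![H₂ 0 0, 0, H₂ 0 1; 0, h, 0; H₂ 1 0, 0, H₂ 1 1] : Matrix (Fin 3) (Fin 3) K) M)
    (hb : ∀ a : K, (Pi.single 1 a : Fin 3 → K) ∈ M ↔ Valued.v a ≤ Valued.v ϖ ^ 1)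
    {g : GL (Fin 2) K} (hg : IsSelfDualLattice σ ϖ H₂ (latt (g : Matrix (Fin 2) (Fin 2) K))) :
    M ⊓ LinearMap.ker ((LinearMap.proj (1 : Fin 3) : (Fin 3 → K) →ₗ[K] K).restrictScalars 𝒪[K]) ⊔ scaleLattice (ϖ ^ 1) M ⊔ Submodule.span 𝒪[K] {(Pi.single 1 1 : Fin 3 → K)} = latt ((endoGL (g, (1 : GL (Fin 1) K)) : GL (Fin 3) K) : Matrix (Fin 3) (Fin 3) K) ↔
      scaleLattice (ϖ ^ 1) M ≤ latt ((endoGL (g, (1 : GL (Fin 1) K)) : GL (Fin 3) K) : Matrix (Fin 3) (Fin 3) K) := by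
  constructor
  · intro hA; rw [← hA]; exact le_sup_right.trans le_sup_left
  · exact axisVertex_eq_latt_endoGL_of_scaleLattice_le σ hσ hvσ hϖ hH₂ hH₂σ hh hhσ hM hb hg

end Literature.NumberTheory.Automorphic.UnitaryLatticeTree

end
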